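import Mathlib.Analysis.SpecialFunctions.Log.Deriv
import Mathlib.Analysis.SpecialFunctions.Sqrt
import Mathlib.Analysis.SpecialFunctions.Trigonometric.Deriv
import Literature.Analysis.FluidPDE.PineauVicolRSS
import Literature.Analysis.FluidPDE.PineauVicolRSSChaeWolf
import Literature.Analysis.FluidPDE.SwirlTransportProofs
import Literature.Analysis.FluidPDE.WeakSolution
import HarnessLib

/-!
# Route TypeICertificateLadder — crux `Target` (item stmt-NavierStokesRegularity-1217),
# line `killing-twisted-bernoulli-solitons`: the infinitesimal spiral-scaling symmetry of the
# RSS ansatz (sub-goal SB2, stub `solitonBridge_generator`)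

Helper file (theorems only). Pineau–Vicol's rotated self-similar (RSS) ansatz field
(arXiv:2607.09619, (1.7)) of a time-independent profile `U : ℝ³ → ℝ³` with rotation speed `α`,
`v(t, x) = (−t)^{−1/2} R(αs) U(R(−αs) x/√(−t))`, `s = −log(−t)` (`pvAnsatz α (fun y _ => U y)`),
is invariant under the one-parameter *spiral-scaling* group
`v(t, x) = μ R(φ) v(μ² t, μ R(−φ) x)`, `φ = 2α log μ`, `μ > 0`
(`s(μ²t) = s(t) − 2 log μ`, `√(−μ²t) = μ√(−t)`, rotations about `e₃` add angles), equivalently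
`R(−φ(μ)) v(t, x) = μ v(μ² t, μ R(−φ(μ)) x)`.
Differentiating this identity at `μ = 1` (chain rule through the jointly `C¹` field on the open
slab `t < 0`, for a `C¹` profile) gives the generator clause
`D(v t)(x)[x + A x] + v t x + 2t ∂ₜv(t, x) − A (v t x) = 0`, `A = (−2α) J`, `J = rotGenL` the
generator of the rotations about `e₃` — the clause of the spiral-scaling Liouville items of the
sibling routes (`ExtremalTypeIConstant.SpiralScalingLiouville`,
`SymmetryModuliCount.SymmetricLiouville`).

All statements are folklore calculus about the explicit formula (1.7).

## References

* B. Pineau, V. Vicol, arXiv:2607.09619 (2026): §1.2, (1.6)–(1.7), Remark 1.5. [PineauVicol2026]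
-/

noncomputable section

-- the summit and its single sub-problem share the name (CONVENTIONS §1), as in every Theorems file
set_option linter.dupNamespace false

namespace Summit.NavierStokesRegularity.NavierStokesRegularity.Theorems

open Set Function Filter
open scoped Topology ContDiff
open Literature.Analysis.FluidPDE

/-! ## The rotation about the axis: linearity, expansion through the generator, smoothness -/

/-- The rotation about the axis commutes with scalars: `R_θ (c • v) = c • R_θ v`. [folklore] -/
private theorem solitonBridge_gen_rotZ_smul (θ c : ℝ) (v : EuclideanSpace ℝ (Fin 3)) :
    rotZ θ (c • v) = c • rotZ θ v := by
  ext i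
  fin_cases i <;> simp <;> ring

/-- The rotation about the axis through its (continuous linear) generator:
`R_θ v = v + sin θ • Jv + (1 − cos θ) • J(Jv)` (`J = rotGenL`). [folklore] -/
private theorem solitonBridge_gen_rotZ_eq_rotGenL (θ : ℝ) (v : EuclideanSpace ℝ (Fin 3)) :
    rotZ θ v = v + Real.sin θ • rotGenL v + (1 - Real.cos θ) • rotGenL (rotGenL v) := by
  ext i
  fin_cases i <;> simp [rotZ, rotGen] <;> ring

/-- Joint `Cⁿ` regularity of the rotation in the angle and the vector: if `θ : E → ℝ` and
`V : E → ℝ³` are `Cⁿ` on `s`, so is `z ↦ R_{θ(z)} V(z)`. [folklore] -/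
private theorem solitonBridge_gen_contDiffOn_rotZ {E : Type*} [NormedAddCommGroup E]
    [NormedSpace ℝ E] {n : WithTop ℕ∞} {s : Set E} {θ : E → ℝ}
    {V : E → EuclideanSpace ℝ (Fin 3)} (hθ : ContDiffOn ℝ n θ s) (hV : ContDiffOn ℝ n V s) :
    ContDiffOn ℝ n (fun z => rotZ (θ z) (V z)) s := by
  have e : (fun z => rotZ (θ z) (V z)) = fun z =>
      V z + Real.sin (θ z) • rotGenL (V z) + (1 - Real.cos (θ z)) • rotGenL (rotGenL (V z)) :=
    funext fun z => solitonBridge_gen_rotZ_eq_rotGenL _ _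
  rw [e]
  have hJ : ContDiffOn ℝ n (fun z => rotGenL (V z)) s := rotGenL.contDiff.comp_contDiffOn hV
  have hJJ : ContDiffOn ℝ n (fun z => rotGenL (rotGenL (V z))) s :=
    rotGenL.contDiff.comp_contDiffOn hJ
  exact (hV.add ((Real.contDiff_sin.comp_contDiffOn hθ).smul hJ)).add
    ((contDiffOn_const.sub (Real.contDiff_cos.comp_contDiffOn hθ)).smul hJJ)

/-- The angle curve `μ ↦ −2α log μ` has derivative `−2α` at `μ = 1`. [folklore] -/
private theorem solitonBridge_gen_hasDerivAt_angle (α : ℝ) :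
    HasDerivAt (fun μ : ℝ => -(2 * α * Real.log μ)) (-(2 * α)) 1 := by
  have h := ((Real.hasDerivAt_log (one_ne_zero : (1 : ℝ) ≠ 0)).const_mul (2 * α)).fun_neg
  simpa using h

/-- The spiral curve `μ ↦ R(−2α log μ) w` has velocity `(−2α) • J w` at `μ = 1`. [folklore] -/
private theorem solitonBridge_gen_hasDerivAt_rotZ_log (α : ℝ) (w : EuclideanSpace ℝ (Fin 3)) :
    HasDerivAt (fun μ : ℝ => rotZ (-(2 * α * Real.log μ)) w) ((-(2 * α)) • rotGen w) 1 := by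
  have hR : HasDerivAt (fun θ : ℝ => rotZ θ w) (rotGen w) 0 := hasDerivAt_rotZ_zero w
  exact hR.scomp_of_eq (1 : ℝ) (solitonBridge_gen_hasDerivAt_angle α) (by simp)

/-! ## Joint `C¹` regularity of the ansatz field on the open slab `t < 0` -/

/-- **Joint `C¹` regularity of the RSS ansatz field of a `C¹` time-independent profile.** For
`U ∈ C¹(ℝ³; ℝ³)` and every `α`, the field `(t, x) ↦ (−t)^{−1/2} R(αs) U(R(−αs) x/√(−t))`,
`s = −log(−t)` (Pineau–Vicol (1.7)), is `C¹` on `(−∞, 0) × ℝ³`. [folklore] -/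
private theorem solitonBridge_gen_contDiffOn_pvAnsatz {α : ℝ}
    {U : EuclideanSpace ℝ (Fin 3) → EuclideanSpace ℝ (Fin 3)} (hU : ContDiff ℝ 1 U) :
    ContDiffOn ℝ 1 (uncurry (pvAnsatz α (fun y _ => U y)))
      (Iio (0 : ℝ) ×ˢ (univ : Set (EuclideanSpace ℝ (Fin 3)))) := by
  have hpos : ∀ z ∈ Iio (0 : ℝ) ×ˢ (univ : Set (EuclideanSpace ℝ (Fin 3))), 0 < -z.1 :=
    fun z hz => neg_pos.2 (mem_Iio.1 hz.1)
  -- the scalar ingredients `-t`, `(√(-t))⁻¹`, `θ = α · (−log(−t))`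
  have hneg : ContDiffOn ℝ 1 (fun z : ℝ × EuclideanSpace ℝ (Fin 3) => -z.1)
      (Iio (0 : ℝ) ×ˢ univ) :=
    contDiffOn_fst.neg
  have hL : ContDiffOn ℝ 1 (fun z : ℝ × EuclideanSpace ℝ (Fin 3) => (Real.sqrt (-z.1))⁻¹)
      (Iio (0 : ℝ) ×ˢ univ) :=
    (hneg.sqrt fun z hz => (hpos z hz).ne').inv fun z hz => (Real.sqrt_pos.2 (hpos z hz)).ne'
  have hθ : ContDiffOn ℝ 1 (fun z : ℝ × EuclideanSpace ℝ (Fin 3) => α * -Real.log (-z.1))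
      (Iio (0 : ℝ) ×ˢ univ) :=
    contDiffOn_const.mul (hneg.log fun z hz => (hpos z hz).ne').neg
  -- the inner point `y = R(−θ) (λ x)`, the profile there, the outer rotation, the amplitude
  have hy : ContDiffOn ℝ 1 (fun z : ℝ × EuclideanSpace ℝ (Fin 3) =>
      rotZ (-(α * -Real.log (-z.1))) ((Real.sqrt (-z.1))⁻¹ • z.2)) (Iio (0 : ℝ) ×ˢ univ) :=
    solitonBridge_gen_contDiffOn_rotZ hθ.neg (hL.smul contDiffOn_snd)
  have hUy : ContDiffOn ℝ 1 (fun z : ℝ × EuclideanSpace ℝ (Fin 3) =>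
      U (rotZ (-(α * -Real.log (-z.1))) ((Real.sqrt (-z.1))⁻¹ • z.2))) (Iio (0 : ℝ) ×ˢ univ) :=
    hU.comp_contDiffOn hy
  have hR : ContDiffOn ℝ 1 (fun z : ℝ × EuclideanSpace ℝ (Fin 3) =>
      rotZ (α * -Real.log (-z.1))
        (U (rotZ (-(α * -Real.log (-z.1))) ((Real.sqrt (-z.1))⁻¹ • z.2))))
      (Iio (0 : ℝ) ×ˢ univ) :=
    solitonBridge_gen_contDiffOn_rotZ hθ hUy
  exact (hL.smul hR).congr fun z _ => rfl

/-! ## Calculus on the open slab `(-∞, 0) × ℝ³` for jointly `C¹` fields -/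

/-- A field jointly `C¹` on the open slab `(-∞, 0) × ℝ³` has a Fréchet derivative (its `fderiv`)
at every point `(t, x)` with `t < 0`. [folklore] -/
private theorem solitonBridge_gen_hasFDerivAt_uncurry
    {u : ℝ → EuclideanSpace ℝ (Fin 3) → EuclideanSpace ℝ (Fin 3)}
    (h : ContDiffOn ℝ 1 (uncurry u) (Iio 0 ×ˢ univ)) {t : ℝ} (ht : t < 0)
    (x : EuclideanSpace ℝ (Fin 3)) :
    HasFDerivAt (uncurry u) (fderiv ℝ (uncurry u) (t, x)) (t, x) := by
  have hO : IsOpen (Iio (0 : ℝ) ×ˢ (univ : Set (EuclideanSpace ℝ (Fin 3)))) :=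
    isOpen_Iio.prod isOpen_univ
  have hmem : ((t, x) : ℝ × EuclideanSpace ℝ (Fin 3)) ∈
      Iio (0 : ℝ) ×ˢ (univ : Set (EuclideanSpace ℝ (Fin 3))) :=
    mk_mem_prod ht (mem_univ _)
  exact ((h.contDiffAt (hO.mem_nhds hmem)).differentiableAt one_ne_zero).hasFDerivAt

/-- On the open slab the time derivative is the partial derivative `D(uncurry u)(t, x)(1, 0)`
(chain rule along `s ↦ (s, x)`). [folklore] -/
private theorem solitonBridge_gen_timeDeriv_eq
    {u : ℝ → EuclideanSpace ℝ (Fin 3) → EuclideanSpace ℝ (Fin 3)}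
    (h : ContDiffOn ℝ 1 (uncurry u) (Iio 0 ×ˢ univ)) {t : ℝ} (ht : t < 0)
    (x : EuclideanSpace ℝ (Fin 3)) :
    timeDeriv u t x =
      fderiv ℝ (uncurry u) (t, x) ((1 : ℝ), (0 : EuclideanSpace ℝ (Fin 3))) := by
  have h1 : HasDerivAt (fun s : ℝ => ((s, x) : ℝ × EuclideanSpace ℝ (Fin 3)))
      ((1 : ℝ), (0 : EuclideanSpace ℝ (Fin 3))) t :=
    (hasDerivAt_id' t).prodMk (hasDerivAt_const t x)
  have h2 := (solitonBridge_gen_hasFDerivAt_uncurry h ht x).comp_hasDerivAt t h1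
  rw [timeDeriv_apply]
  exact h2.deriv

/-- On the open slab the slice derivative is the partial derivative `D(uncurry u)(t, x)(0, w)`
(chain rule along `y ↦ (t, y)`). [folklore] -/
private theorem solitonBridge_gen_fderiv_slice_eq
    {u : ℝ → EuclideanSpace ℝ (Fin 3) → EuclideanSpace ℝ (Fin 3)}
    (h : ContDiffOn ℝ 1 (uncurry u) (Iio 0 ×ˢ univ)) {t : ℝ} (ht : t < 0)
    (x w : EuclideanSpace ℝ (Fin 3)) :
    fderiv ℝ (u t) x w = fderiv ℝ (uncurry u) (t, x) ((0 : ℝ), w) := by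
  have h1 : HasFDerivAt
      (fun y : EuclideanSpace ℝ (Fin 3) => ((t, y) : ℝ × EuclideanSpace ℝ (Fin 3)))
      (ContinuousLinearMap.inr ℝ ℝ (EuclideanSpace ℝ (Fin 3))) x :=
    hasFDerivAt_prodMk_right t x
  have h2 : HasFDerivAt (u t) ((fderiv ℝ (uncurry u) (t, x)).comp
      (ContinuousLinearMap.inr ℝ ℝ (EuclideanSpace ℝ (Fin 3)))) x :=
    (solitonBridge_gen_hasFDerivAt_uncurry h ht x).comp x h1
  rw [h2.fderiv]
  rfl

/-- **Derivative along the spiral-scaling orbit at the identity.** For a field jointly `C¹` on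
the open slab, `t < 0` and `x ∈ ℝ³`, the curve `μ ↦ μ • u(μ² t, μ • R(−2α log μ) x)` has
derivative `D(u t)(x)[x + A x] + u t x + 2t ∂ₜu(t, x)` at `μ = 1`, `A = (−2α) J`. [folklore] -/
private theorem solitonBridge_gen_hasDerivAt_orbit
    {u : ℝ → EuclideanSpace ℝ (Fin 3) → EuclideanSpace ℝ (Fin 3)}
    (h : ContDiffOn ℝ 1 (uncurry u) (Iio 0 ×ˢ univ)) (α : ℝ) {t : ℝ} (ht : t < 0)
    (x : EuclideanSpace ℝ (Fin 3)) :
    HasDerivAt (fun μ : ℝ => μ • u (μ ^ 2 * t) (μ • rotZ (-(2 * α * Real.log μ)) x))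
      (fderiv ℝ (u t) x (x + ((-(2 * α)) • rotGenL) x) + u t x + (2 * t) • timeDeriv u t x)
      1 := by
  -- the curve `μ ↦ (μ² t, μ • R(−2α log μ) x)` through `(t, x)` at `μ = 1`
  have hc1 : HasDerivAt (fun m : ℝ => m ^ 2 * t) (2 * t) 1 := by
    simpa using (hasDerivAt_pow 2 (1 : ℝ)).mul_const t
  have hc2 : HasDerivAt (fun m : ℝ => m • rotZ (-(2 * α * Real.log m)) x)
      (x + ((-(2 * α)) • rotGenL) x) 1 := by
    have h2 : HasDerivAt (fun m : ℝ => m • rotZ (-(2 * α * Real.log m)) x)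
        ((1 : ℝ) • ((-(2 * α)) • rotGen x) + (1 : ℝ) • rotZ (-(2 * α * Real.log 1)) x) 1 :=
      (hasDerivAt_id' (1 : ℝ)).smul (solitonBridge_gen_hasDerivAt_rotZ_log α x)
    refine h2.congr_deriv ?_
    rw [one_smul, one_smul, Real.log_one, mul_zero, neg_zero, rotZ_zero, add_comm]
    rfl
  have hc : HasDerivAt
      (fun m : ℝ => ((m ^ 2 * t, m • rotZ (-(2 * α * Real.log m)) x) :
        ℝ × EuclideanSpace ℝ (Fin 3)))
      ((2 * t, x + ((-(2 * α)) • rotGenL) x) : ℝ × EuclideanSpace ℝ (Fin 3)) 1 :=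
    hc1.prodMk hc2
  have hd : HasFDerivAt (uncurry u) (fderiv ℝ (uncurry u) (t, x))
      (((1 : ℝ) ^ 2 * t, (1 : ℝ) • rotZ (-(2 * α * Real.log 1)) x) :
        ℝ × EuclideanSpace ℝ (Fin 3)) := by
    rw [one_pow, one_mul, Real.log_one, mul_zero, neg_zero, rotZ_zero, one_smul]
    exact solitonBridge_gen_hasFDerivAt_uncurry h ht x
  have hcomp := hd.comp_hasDerivAt (1 : ℝ) hc
  have hg : HasDerivAt (fun μ : ℝ => μ • u (μ ^ 2 * t) (μ • rotZ (-(2 * α * Real.log μ)) x))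
      ((1 : ℝ) • fderiv ℝ (uncurry u) (t, x)
          ((2 * t, x + ((-(2 * α)) • rotGenL) x) : ℝ × EuclideanSpace ℝ (Fin 3))
        + (1 : ℝ) • u ((1 : ℝ) ^ 2 * t) ((1 : ℝ) • rotZ (-(2 * α * Real.log 1)) x)) 1 :=
    (hasDerivAt_id' (1 : ℝ)).smul hcomp
  refine hg.congr_deriv ?_
  have hsplit : ((2 * t, x + ((-(2 * α)) • rotGenL) x) : ℝ × EuclideanSpace ℝ (Fin 3)) =
      (2 * t) • ((1 : ℝ), (0 : EuclideanSpace ℝ (Fin 3)))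
        + ((0 : ℝ), x + ((-(2 * α)) • rotGenL) x) := by
    ext <;> simp
  rw [hsplit, map_add, map_smul, ← solitonBridge_gen_timeDeriv_eq h ht,
    ← solitonBridge_gen_fderiv_slice_eq h ht, one_smul, one_smul, one_pow, one_mul, Real.log_one,
    mul_zero, neg_zero, rotZ_zero, one_smul]
  abel

/-- **The generator clause from the spiral-scaling invariance.** If a field `u` is jointly `C¹`
on the open slab and, at a point `(t, x)` with `t < 0`, satisfies
`R(−2α log μ) u(t, x) = μ u(μ² t, μ R(−2α log μ) x)` for all `μ > 0`, then
`D(u t)(x)[x + A x] + u t x + 2t ∂ₜu(t, x) − A (u t x) = 0` with `A = (−2α) J`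
(differentiate at `μ = 1` and compare the two sides). [folklore] -/
private theorem solitonBridge_gen_clause_of_invariance
    {u : ℝ → EuclideanSpace ℝ (Fin 3) → EuclideanSpace ℝ (Fin 3)}
    (h : ContDiffOn ℝ 1 (uncurry u) (Iio 0 ×ˢ univ)) (α : ℝ) {t : ℝ} (ht : t < 0)
    (x : EuclideanSpace ℝ (Fin 3))
    (hinv : ∀ μ : ℝ, 0 < μ → rotZ (-(2 * α * Real.log μ)) (u t x) =
      μ • u (μ ^ 2 * t) (μ • rotZ (-(2 * α * Real.log μ)) x)) :
    fderiv ℝ (u t) x (x + ((-(2 * α)) • rotGenL) x) + u t x + (2 * t) • timeDeriv u t x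
      - ((-(2 * α)) • rotGenL) (u t x) = 0 := by
  have h1 : HasDerivAt (fun μ : ℝ => rotZ (-(2 * α * Real.log μ)) (u t x))
      ((-(2 * α)) • rotGen (u t x)) 1 :=
    solitonBridge_gen_hasDerivAt_rotZ_log α (u t x)
  have h2 := solitonBridge_gen_hasDerivAt_orbit h α ht x
  have heq : (fun μ : ℝ => μ • u (μ ^ 2 * t) (μ • rotZ (-(2 * α * Real.log μ)) x)) =ᶠ[𝓝 1]
      (fun μ : ℝ => rotZ (-(2 * α * Real.log μ)) (u t x)) :=
    eventuallyEq_of_mem (Ioi_mem_nhds one_pos) fun μ hμ => (hinv μ hμ).symm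
  have key := (h1.congr_of_eventuallyEq heq).unique h2
  rw [sub_eq_zero, ← key]
  rfl

/-! ## The spiral-scaling invariance of the RSS ansatz field -/

/-- **Spiral-scaling invariance of the RSS ansatz (Pineau–Vicol (1.7)).** For `t < 0`, `μ > 0`
and `φ = 2α log μ`: `R(−φ) v(t, x) = μ v(μ² t, μ R(−φ) x)` for the ansatz field
`v = pvAnsatz α (fun y _ => U y)` (`s(μ²t) = s(t) − 2 log μ`, `√(−μ²t) = μ√(−t)`, and the
rotations about `e₃` commute with scalars and add angles; compare Remark 1.5, the case
`φ ∈ 2πℤ`). [cite: PineauVicol2026, (1.7) and Remark 1.5 (arXiv:2607.09619 pp. 3, 5)] -/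
private theorem solitonBridge_gen_invariance (α : ℝ)
    (U : EuclideanSpace ℝ (Fin 3) → EuclideanSpace ℝ (Fin 3)) {t : ℝ} (ht : t < 0)
    (x : EuclideanSpace ℝ (Fin 3)) {μ : ℝ} (hμ : 0 < μ) :
    rotZ (-(2 * α * Real.log μ)) (pvAnsatz α (fun y _ => U y) t x) =
      μ • pvAnsatz α (fun y _ => U y) (μ ^ 2 * t) (μ • rotZ (-(2 * α * Real.log μ)) x) := by
  have hnt : 0 < -t := by linarith
  have hs : 0 < Real.sqrt (-t) := Real.sqrt_pos.2 hnt
  have hsqrt : Real.sqrt (-(μ ^ 2 * t)) = μ * Real.sqrt (-t) := by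
    rw [show -(μ ^ 2 * t) = μ ^ 2 * (-t) by ring, Real.sqrt_mul (sq_nonneg μ), Real.sqrt_sq hμ.le]
  have hlog : Real.log (-(μ ^ 2 * t)) = 2 * Real.log μ + Real.log (-t) := by
    rw [show -(μ ^ 2 * t) = μ ^ 2 * (-t) by ring, Real.log_mul (by positivity) hnt.ne',
      Real.log_pow]
    push_cast
    ring
  simp only [pvAnsatz]
  rw [hsqrt, hlog]
  -- the inner point is the same on both sides
  have hin : (μ * Real.sqrt (-t))⁻¹ • (μ • rotZ (-(2 * α * Real.log μ)) x) =
      rotZ (-(2 * α * Real.log μ)) ((Real.sqrt (-t))⁻¹ • x) := by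
    rw [smul_smul, solitonBridge_gen_rotZ_smul]
    congr 1
    field_simp
  have hrot : rotZ (-(α * -(2 * Real.log μ + Real.log (-t))))
      (rotZ (-(2 * α * Real.log μ)) ((Real.sqrt (-t))⁻¹ • x)) =
      rotZ (-(α * -Real.log (-t))) ((Real.sqrt (-t))⁻¹ • x) := by
    rw [← rotZ_add]
    congr 1
    ring
  rw [hin, hrot]
  -- the outer rotation and the amplitude
  set W := U (rotZ (-(α * -Real.log (-t))) ((Real.sqrt (-t))⁻¹ • x))
  rw [solitonBridge_gen_rotZ_smul, ← rotZ_add, smul_smul]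
  congr 1
  · field_simp
  · congr 1
    ring

/-! ## The registered stub -/

/-- **Stub `solitonBridge_generator` (SB2) — the infinitesimal spiral-scaling symmetry of the RSS
ansatz.** For a `C¹` profile `U`, a rotation speed `α`, `t < 0` and `x ∈ ℝ³`, the Pineau–Vicol
ansatz field `v = pvAnsatz α (fun y _ => U y)` ((1.7):
`v(t,x) = (−t)^{−1/2} R(αs) U(R(−αs)x/√(−t))`, `s = −log(−t)`) is annihilated by the generator
of the spiral-scaling group `v ↦ μ R(2α log μ) v(μ²·, μ R(−2α log μ)·)`:
`D(v t)(x)[x + A x] + v t x + 2t ∂ₜv(t, x) − A (v t x) = 0`, `A = (−2α) • rotGenL`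
(the `μ`-derivative at `μ = 1` of the invariance identity). [cite: PineauVicol2026, (1.7) and §1.2 (arXiv:2607.09619 p. 3)] -/
theorem solitonBridge_generator : ∀ (α : ℝ) (U : EuclideanSpace ℝ (Fin 3) → EuclideanSpace ℝ (Fin 3)), ContDiff ℝ 1 U → ∀ t < 0, ∀ x : EuclideanSpace ℝ (Fin 3), fderiv ℝ (Literature.Analysis.FluidPDE.pvAnsatz α (fun y _ => U y) t) x (x + ((-(2 * α)) • Literature.Analysis.FluidPDE.rotGenL) x) + Literature.Analysis.FluidPDE.pvAnsatz α (fun y _ => U y) t x + (2 * t) • Literature.Analysis.FluidPDE.timeDeriv (Literature.Analysis.FluidPDE.pvAnsatz α (fun y _ => U y)) t x - ((-(2 * α)) • Literature.Analysis.FluidPDE.rotGenL) (Literature.Analysis.FluidPDE.pvAnsatz α (fun y _ => U y) t x) = 0 := by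
  intro α U hU t ht x
  exact solitonBridge_gen_clause_of_invariance (solitonBridge_gen_contDiffOn_pvAnsatz hU) α ht x
    fun μ hμ => solitonBridge_gen_invariance α U ht x hμ

end Summit.NavierStokesRegularity.NavierStokesRegularity.Theorems

end
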